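import Mathlib
import Summits.ResolutionOfSingularities.ResolutionOfSingularities.Theorems.WeightedInvariantLocalWeightedDropNCResCurveGraphDefs
import Summits.ResolutionOfSingularities.ResolutionOfSingularities.Theorems.WeightedInvariantLocalWeightedDropTOT2Near
import Summits.ResolutionOfSingularities.ResolutionOfSingularities.Theorems.WeightedInvariantLocalWeightedDropMultiplicityLift

/-!
# `WeightedInvariant.LocalWeightedDrop`: the TOT₂ line, regime (B) — the LEVEL of a germ along a coordinate axis, and its drop under the
# identity point move at the axis point

Crux item stmt-ResolutionOfSingularities-8899 `LocalWeightedDrop` (route `ResolutionOfSingularities/WeightedInvariant`), ENGINE skeleton v33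
(res-L1-w43-lead-1 g5, TOT2-LINE v1.3 §1 (B)), registered regime stub `stub_regimeBad` (deal → res-type-056).  [OURS · L1 W4.3 · chain w43 · seat
res-type-056; def-free on res-L1-w43-stub-1's `GraphCurve.offDeg / InOffIdeal` (…NCResCurveGraphDefs); the count game is the programme's own;
nothing here is a statement of any manuscript; AI-produced, gate-checked, weaker than expert review.]

WHAT.  For a germ `g` of order `d` and a letter `j`, the `j`-AXIS `C_j = ⋂_{l ≠ j} V(x_l)` and Hironaka's `δ`-invariant of the polyhedron
`Δ(g; x_{≠ j}; x_j)`, compared with integer levels — written INLINE (no new definition) as the predicate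
`Level_j(r) :≡ ∀ E, offDeg j E < d → E j < r · (d − offDeg j E) → coeff E g = 0` (`= AxisPolyhedron.AboveLevel d r 1` when `j` is the last
letter; `offDeg j E = Σ_{l ≠ j} E_l` is res-L1-w43-stub-1's off-`j` degree).  `Level_j(r)` for all `r` is `GraphCurve.InOffIdeal j d g`
(`g ∈ (x_l : l ≠ j)^d`, `C_j` permissible).  Lemmas:
* `exists_not_level_of_not_inOffIdeal` — if `C_j` is NOT permissible, some integer level fails;
* `one_le_of_not_level` — level `0` never fails;
* **`not_level_slice_of_not_level`** — THE LEVEL DROPS BY ONE under the identity point move at the AXIS POINT `c = c_j e_j` (slot `j`): if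
  level `r + 1` fails for `g` then level `r` fails for the sliced strict transform `G|_{y_j = 0}` (`g(s(c + y)) = s^d · G`) along the NEW axis
  (the exceptional letter `s = x_0`; the through-going letters `i.succAbove p ↦ p⁺`).  Proof: the exponent bijection `E ↦ (|E| − d; E_{j.succAbove ·})`
  of the axis-point chart (res-L1-w43-stub-3's Hasse–Taylor formula `TOT2Near.taylorSum_eq_coeff_slice`, whose sum collapses to the single term
  `c_j^{E_j} · coeff_E g` because `c_l = 0` off `j`) — res-L1-w43-stub-4's `AxisNearDescent.aboveLevel_nearSucc_iff` in game coordinates.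
-/

set_option linter.dupNamespace false -- mandated namespace of this single-conjunct summit

noncomputable section

namespace Summit.ResolutionOfSingularities.ResolutionOfSingularities.Theorems

namespace TameFourTupleDrop

namespace NCResBad

open MvPowerSeries Literature.AlgebraicGeometry.Resolution GraphCurve

variable {k : Type} [Field k] {m : ℕ}

/-! ## The level along a letter's axis -/

/-- The off-`j` degree is the sum over the other letters, indexed by `j.succAbove`. -/
theorem offDeg_eq_sum_succAbove (j : Fin (m + 1)) (E : Fin (m + 1) →₀ ℕ) : offDeg j E = ∑ p : Fin m, E (j.succAbove p) := by
  have h := Fin.sum_univ_succAbove (fun l => E l) j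
  rw [← Finset.add_sum_erase _ _ (Finset.mem_univ j)] at h
  exact add_left_cancel h

/-- **If the `j`-axis is not permissible, some integer level fails.** -/
theorem exists_not_level_of_not_inOffIdeal {j : Fin (m + 1)} {d : ℕ} {g : MvPowerSeries (Fin (m + 1)) k} (h : ¬ InOffIdeal j d g) :
    ∃ r : ℕ, ¬ (∀ E : Fin (m + 1) →₀ ℕ, offDeg j E < d → E j < r * (d - offDeg j E) → coeff E g = 0) := by
  unfold InOffIdeal at h
  push Not at h
  obtain ⟨E, hE, hlt⟩ := h
  refine ⟨E j + 1, fun hall => hE (hall E hlt ?_)⟩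
  have h1 : 1 ≤ d - offDeg j E := by omega
  calc E j < E j + 1 := Nat.lt_succ_self _
    _ = (E j + 1) * 1 := (mul_one _).symm
    _ ≤ (E j + 1) * (d - offDeg j E) := Nat.mul_le_mul_left _ h1

/-- Level `0` never fails. -/
theorem one_le_of_not_level {j : Fin (m + 1)} {d r : ℕ} {g : MvPowerSeries (Fin (m + 1)) k}
    (h : ¬ (∀ E : Fin (m + 1) →₀ ℕ, offDeg j E < d → E j < r * (d - offDeg j E) → coeff E g = 0)) : 1 ≤ r := by
  by_contra hr
  have hr0 : r = 0 := by omega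
  exact h fun E _ hlt => absurd hlt (by rw [hr0, zero_mul]; exact Nat.not_lt_zero _)

/-! ## The axis-point chart reads single coefficients -/

/-- **THE AXIS-POINT CHART READS SINGLE COEFFICIENTS**: at the axis point `c = c_j e_j` (slot `j`), the coefficient of `s^{|E|} · y^{E∘j.succAbove}`
in the sliced chart transform `g(s(c+y))|_{y_j=0}` is `c_j^{E_j} · coeff_E g`. -/
theorem coeff_slice_chart_axisPoint {j : Fin (m + 1)} {c : Fin (m + 1) → k} (hc : ∀ l, l ≠ j → c l = 0)
    (g : MvPowerSeries (Fin (m + 1)) k) (E : Fin (m + 1) →₀ ℕ) :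
    coeff (Finsupp.cons E.degree (Finsupp.equivFunOnFinite.symm fun p => E (j.succAbove p)))
        (TupleGame.slice j (subst (CobordantChart.chart (fun _ : Fin (m + 1) => 1) c) g)) = c j ^ E j * coeff E g := by
  classical
  -- the Hasse–Taylor sum for `β := E` with `β_j := 0`
  set β : Fin (m + 1) →₀ ℕ := Finsupp.erase j E with hβ
  have hβj : β j = 0 := Finsupp.erase_same
  have hβl : ∀ l, l ≠ j → β l = E l := fun l hl => Finsupp.erase_ne hl
  have hβ' : (fun p => β (j.succAbove p)) = fun p => E (j.succAbove p) := funext fun p => hβl _ (Fin.succAbove_ne j p)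
  have h := TOT2Near.taylorSum_eq_coeff_slice g c j E.degree β hβj
  rw [hβ'] at h
  rw [← h, Finset.sum_eq_single E]
  · -- the `E` term
    rw [Finset.prod_eq_single j]
    · rw [hβj, Nat.choose_zero_right, Nat.cast_one, one_mul, Nat.sub_zero, mul_comm]
    · intro l _ hl
      rw [hβl l hl, Nat.choose_self, Nat.cast_one, one_mul, Nat.sub_self, pow_zero]
    · intro h; exact absurd (Finset.mem_univ j) h
  · -- the other exponents of degree `|E|` do not contribute: some letter `l ≠ j` differs, and `c_l = 0`
    intro e he hne
    rw [Finset.mem_finsuppAntidiag] at he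
    have hl : ∃ l, l ≠ j ∧ e l ≠ E l := by
      by_contra hall
      push Not at hall
      apply hne
      -- `e` and `E` agree off `j` and have the same degree
      have hsum : ∑ l, e l = ∑ l, E l := by rw [he.1, Finsupp.degree_eq_sum]
      have hej : e j = E j := by
        rw [Fin.sum_univ_succAbove _ j, Fin.sum_univ_succAbove _ j] at hsum
        have hoff : ∑ p : Fin m, e (j.succAbove p) = ∑ p : Fin m, E (j.succAbove p) :=
          Finset.sum_congr rfl fun p _ => hall _ (Fin.succAbove_ne j p)
        omega
      ext l
      by_cases hlj : l = j
      · rw [hlj, hej]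
      · exact hall l hlj
    obtain ⟨l, hlj, hl⟩ := hl
    refine mul_eq_zero_of_right _ (Finset.prod_eq_zero (Finset.mem_univ l) ?_)
    rw [hβl l hlj, hc l hlj]
    rcases Nat.lt_or_gt_of_ne hl with hlt | hgt
    · rw [Nat.choose_eq_zero_of_lt hlt, Nat.cast_zero, zero_mul]
    · rw [zero_pow (Nat.sub_ne_zero_of_lt hgt), mul_zero]
  · intro hE
    exact absurd (Finset.mem_finsuppAntidiag.mpr ⟨by rw [Finsupp.degree_eq_sum], Finset.subset_univ _⟩) hE

/-! ## The level drops by one at the axis point -/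

/-- **THE LEVEL DROPS BY ONE AT THE AXIS POINT.**  Let `g` have all its monomials in degree `≥ d`, let `c = c_j e_j` (`c_j ≠ 0`) be the axis
point and `g(s(c+y)) = s^d · G`.  If level `r + 1` fails for `g` along `x_j`, then level `r` fails for the sliced strict transform `G|_{y_j = 0}`
along the exceptional letter `s = x_0`. -/
theorem not_level_slice_of_not_level {j : Fin (m + 1)} {c : Fin (m + 1) → k} (hc : ∀ l, l ≠ j → c l = 0) (hcj : c j ≠ 0)
    {d : ℕ} {g : MvPowerSeries (Fin (m + 1)) k} (hord : ∀ E : Fin (m + 1) →₀ ℕ, coeff E g ≠ 0 → d ≤ E.degree)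
    {G : MvPowerSeries (Fin (m + 1 + 1)) k} (hfac : subst (CobordantChart.chart (fun _ : Fin (m + 1) => 1) c) g = X 0 ^ d * G) {r : ℕ}
    (hr : ¬ (∀ E : Fin (m + 1) →₀ ℕ, offDeg j E < d → E j < (r + 1) * (d - offDeg j E) → coeff E g = 0)) :
    ¬ (∀ E : Fin (m + 1) →₀ ℕ, offDeg 0 E < d → E 0 < r * (d - offDeg 0 E) → coeff E (TupleGame.slice j G) = 0) := by
  classical
  push Not at hr ⊢
  obtain ⟨E, hoff, hlt, hE⟩ := hr
  have hdeg : d ≤ E.degree := hord E hE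
  have hsum : offDeg j E + E j = E.degree := offDeg_add_apply j E
  -- the new exponent `(|E| - d; E ∘ j.succAbove)`
  set β' : Fin m →₀ ℕ := Finsupp.equivFunOnFinite.symm fun p => E (j.succAbove p) with hβ'
  refine ⟨Finsupp.cons (E.degree - d) β', ?_, ?_, ?_⟩
  · -- off-`0` degree = off-`j` degree of `E`
    rw [offDeg_eq_sum_succAbove]
    simp only [Fin.succAbove_zero, Finsupp.cons_succ, hβ', Finsupp.coe_equivFunOnFinite_symm]
    rw [← offDeg_eq_sum_succAbove]; exact hoff
  · rw [Finsupp.cons_zero, offDeg_eq_sum_succAbove]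
    simp only [Fin.succAbove_zero, Finsupp.cons_succ, hβ', Finsupp.coe_equivFunOnFinite_symm]
    rw [← offDeg_eq_sum_succAbove]
    have h1 : E j < r * (d - offDeg j E) + (d - offDeg j E) := by rw [add_mul, one_mul] at hlt; exact hlt
    omega
  · -- the coefficient is `c_j^{E_j} · coeff_E g ≠ 0`
    have hslice : TupleGame.slice j (subst (CobordantChart.chart (fun _ : Fin (m + 1) => 1) c) g) = X 0 ^ d * TupleGame.slice j G := by
      rw [hfac, MultiplicityLift.slice_X_zero_pow_mul]
    rw [CobordantChart.coeff_cons_of_eq_X_pow_mul hslice, Nat.add_sub_cancel' hdeg, coeff_slice_chart_axisPoint hc g E]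
    exact mul_ne_zero (pow_ne_zero _ hcj) hE

end NCResBad

end TameFourTupleDrop

end Summit.ResolutionOfSingularities.ResolutionOfSingularities.Theorems

end
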